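import Summits.QuantumAdvantage.QuantumAdvantage.Theorems.WbwObfuscatedGluedTreesKowBbVocabulary
import Literature.Computability.Cryptography.LubyRackoffIdealProofs

/-!
# `WbwObfuscatedGluedTrees` (stmt-QuantumAdvantage-2340) — line `knowledge-of-walk-split`, STAGE 6: vocabulary of the
# REAL→IDEAL statistical layer ("ideal model II": the generator's own code over uniformly random PRF tables)

Definitions file (no hardness asserted; no theorem content beyond unfolding / well-formedness lemmas) for stage 6 of the
line `knowledge-of-walk-split` of the INFORMAL crux `WbwObfuscatedGluedTrees` (route `Theses/WhiteBoxWalk`; lead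
prover-line-stmt-QuantumAdvantage-2340-c5-0).  Stage 5 (`…KnowledgeOfWalkSplit.BlackBox.blackBoxSoundness_holds`,
vocabulary `KowBbVocabulary`) bounded black-box walkers in the IDEAL model: uniformly random cycle datum, SIV names over
uniformly random tag / mask tables.  The landed generator (`Literature/Computability/Cryptography/ObfuscatedGluedTrees.lean`)
is not that: its names are `sivEnc` over the PRF `F_{k₁}, F_{k₂}` (values `fit`ted to their nominal lengths) and its
cycle datum is `cycleOf` = two FOUR-ROUND KEYED FEISTEL permutations `prp` of `{0,1}^d` (round functions `roundFn` read off
`F_{k₃}, F_{k₄}`), which the neighbour function queries in BOTH directions (`crossL`/`crossR` use `σ.symm`).  Stage 6 is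
the statistical half of the real→ideal bridge: run the generator's OWN code over four uniformly random `μ`-bit function
tables in place of the four PRF instances (IDEAL MODEL II) and compare with stage 5's ideal model — a Luby–Rackoff /
strong-PRP step for the cycle (coefficient-H technique, `HCoefficient.lean`) and a table-idealisation step for the
naming.  This file is its vocabulary:

* §1 `PrfTable μ` (a `μ`-bit function table), `vecOf`, the TABLE SCHEME `tabScheme H⃗` (a `PuncturablePRFScheme` whose
  evaluation map reads one of four tables selected by a 2-bit key `tkey i`) — so that the generator's own `naming`,
  `cycleOf`, `prp`, `roundFn` are reused verbatim — and the ideal-II objects `codeNaming`, `codeCycle`,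
  `codeSuccessProb`; `tableOf P μ k` (the table of a real PRF key) for the link "generator = code at its own tables";
* §2 the abstract four-round Feistel `psi` on `{0,1}^a × {0,1}^b` over a key of four round functions (`LRKey a b`),
  cylinder events `Cyl`, and the Luby–Rackoff slack `lrSlack a b q = q² (2^{-a} + 2^{-b} + 2^{-(a+b)})`;
* §3 the FORMAT BRIDGE data: `splitVec` (`{0,1}^d ≃ {0,1}^{⌊d/2⌋} × {0,1}^{⌈d/2⌉}` as a function), the effective key
  `effKey H d : LRKey ⌊d/2⌋ ⌈d/2⌉` read off one table;
* §4 LOCALITY data: the atom `atomOf σ v` of the cycle datum at a vertex (for a leaf: the cycle position and the two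
  cross neighbours; `none` elsewhere), the σ-free neighbour set `nbrSetLocal`, and the σ-free renderings
  `nbrNamesL`/`oracleL`/`answerBitsL`/`nbrBitL`/`bitOracleL` of the bit oracle given an atom assignment;
* §5 the tag / mask tables `tagT`, `maskT` of two `μ`-bit tables (the ideal-II naming IS `sivNaming (tagT H₀ d) (maskT H₁ d)`,
  proved in stage 6).

[folklore] modelling conventions of the route; objects: ChildsEtAl2003 §2 / §4 Game 1, LubyRackoff1988 (Feistel networks,
strong pseudorandomness of four rounds), Patarin2009 (coefficient H), Goldreich2004FoC2 Constructions 5.3.9 / 5.4.19.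
-/

set_option linter.dupNamespace false

noncomputable section

namespace Summit.QuantumAdvantage.QuantumAdvantage.Theorems.WbwObfuscatedGluedTrees.KnowledgeOfWalk.RealIdeal

open Literature.Computability.Complexity Literature.Computability.QuantumComplexity
open Literature.Computability.QuantumComplexity.GluedTrees
open Literature.Computability.Cryptography Literature.Computability.Cryptography.ObfuscatedGluedTrees
open Summit.QuantumAdvantage.QuantumAdvantage.Theorems.WbwObfuscatedGluedTrees.KnowledgeOfWalk.BlackBox

/-! ## §1 Tables, the table scheme, and ideal model II -/

/-- A `μ`-bit FUNCTION TABLE `{0,1}^μ → {0,1}^μ`: the ideal stand-in for one PRF instance `x ↦ F_k(x)` of a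
length-preserving PRF run at parameter `μ`. [folklore] -/
abbrev PrfTable (μ : ℕ) : Type := (Fin μ → Bool) → (Fin μ → Bool)

/-- A bit string read as a bit VECTOR of length `m` (cut or zero-padded: `List.ofFn (vecOf m x) = fit m x`). [folklore] -/
def vecOf (m : ℕ) (x : List Bool) : Fin m → Bool := fun i => x.getD i false

/-- Listing a fitted vector gives the fitted string: `List.ofFn (vecOf m x) = fit m x`. [folklore] -/
theorem ofFn_vecOf (m : ℕ) (x : List Bool) : List.ofFn (vecOf m x) = fit m x := by
  apply List.ext_getElem
  · simp [fit]
  intro i h₁ h₂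
  simp only [List.getElem_ofFn, vecOf, fit, List.getElem_take]
  rw [List.getD_eq_getElem?_getD]
  by_cases hx : i < x.length
  · rw [List.getElem_append_left hx, List.getElem?_eq_getElem hx, Option.getD_some]
  · push Not at hx
    rw [List.getElem_append_right hx, List.getElem_replicate, List.getElem?_eq_none hx, Option.getD_none]

/-- Reading back a listed vector: `vecOf m (List.ofFn v) = v`. [folklore] -/
@[simp] theorem vecOf_ofFn {m : ℕ} (v : Fin m → Bool) : vecOf m (List.ofFn v) = v := by
  funext i
  simp [vecOf, List.getD_eq_getElem?_getD]

/-- Fitting to a length `m' ≥ m` first does not change the `m`-bit reading. [folklore] -/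
theorem vecOf_fit {m m' : ℕ} (h : m ≤ m') (x : List Bool) : vecOf m (fit m' x) = vecOf m x := by
  funext i
  have hi : (i : ℕ) < m' := lt_of_lt_of_le i.isLt h
  simp only [vecOf, fit, List.getD_eq_getElem?_getD]
  rw [List.getElem?_take, if_pos hi, List.getElem?_append]
  split_ifs with hx
  · rfl
  · push Not at hx
    rw [List.getElem?_eq_none hx, List.getElem?_replicate]
    split_ifs <;> rfl

/-- `fit m ∘ fit m' = fit m` for `m ≤ m'`. [folklore] -/
theorem fit_fit {m m' : ℕ} (h : m ≤ m') (x : List Bool) : fit m (fit m' x) = fit m x := by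
  rw [← ofFn_vecOf, vecOf_fit h, ofFn_vecOf]

/-- The four tables of ideal model II: a NAMING pair (stand-ins for `F_{k₁}`, `F_{k₂}`) and a CYCLE pair (for
`F_{k₃}`, `F_{k₄}`). [folklore] -/
abbrev CodeSpace (μ : ℕ) : Type := (PrfTable μ × PrfTable μ) × (PrfTable μ × PrfTable μ)

/-- The 2-bit key selecting table `i`. [folklore] -/
def tkey (i : Fin 4) : List Bool := [Nat.testBit i 0, Nat.testBit i 1]

/-- The table index read off a key (first two bits, little-endian). [folklore] -/
def keyIdx (k : List Bool) : Fin 4 :=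
  ⟨(k.getD 0 false).toNat + 2 * (k.getD 1 false).toNat, by
    rcases k.getD 0 false <;> rcases k.getD 1 false <;> simp⟩

/-- `keyIdx (tkey i) = i`. [folklore] -/
@[simp] theorem keyIdx_tkey (i : Fin 4) : keyIdx (tkey i) = i := by
  unfold keyIdx tkey; revert i; decide

/-- The `i`-th table of the code space (`0,1` naming, `2,3` cycle). [folklore] -/
def CodeSpace.tab {μ : ℕ} (H : CodeSpace μ) : Fin 4 → PrfTable μ := ![H.1.1, H.1.2, H.2.1, H.2.2]

/-- Table `0` is the first naming table. [folklore] -/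
@[simp] theorem CodeSpace.tab_zero {μ : ℕ} (H : CodeSpace μ) : H.tab 0 = H.1.1 := rfl
/-- Table `1` is the second naming table. [folklore] -/
@[simp] theorem CodeSpace.tab_one {μ : ℕ} (H : CodeSpace μ) : H.tab 1 = H.1.2 := rfl
/-- Table `2` is the first cycle table. [folklore] -/
@[simp] theorem CodeSpace.tab_two {μ : ℕ} (H : CodeSpace μ) : H.tab 2 = H.2.1 := rfl
/-- Table `3` is the second cycle table. [folklore] -/
@[simp] theorem CodeSpace.tab_three {μ : ℕ} (H : CodeSpace μ) : H.tab 3 = H.2.2 := rfl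

/-- **The table scheme**: a `PuncturablePRFScheme` (syntax only — no security is claimed for it) whose evaluation map at
EVERY parameter reads the table selected by the key: `eval n k x = H_{keyIdx k} (vecOf μ x)` as a `μ`-bit string.
Feeding it to the generator's `naming` / `cycleOf` runs the generator's own code over the tables. [folklore] -/
def tabScheme {μ : ℕ} (H : CodeSpace μ) : PuncturablePRFScheme where
  eval := fun _ k x => List.ofFn (H.tab (keyIdx k) (vecOf μ x))
  punc := fun _ k _ => k
  peval := fun _ k x => List.ofFn (H.tab (keyIdx k) (vecOf μ x))
  keyLen := fun _ => 2
  pkeyLen := fun _ => 2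
  inLen := fun _ => μ
  outLen := fun _ => μ

/-- Unfolding the evaluation map of the table scheme. [folklore] -/
@[simp] theorem tabScheme_eval {μ : ℕ} (H : CodeSpace μ) (n : ℕ) (k x : List Bool) :
    (tabScheme H).eval n k x = List.ofFn (H.tab (keyIdx k) (vecOf μ x)) := rfl

/-- The generator's fitted PRF call `prf` over the table scheme reads table `i` at the `μ`-bit reading of the input and
fits the value: `prf (tabScheme H) μ (tkey i) m x = fit m (H.tab i (vecOf μ x))`. [folklore] -/
theorem prf_tabScheme {μ : ℕ} (H : CodeSpace μ) (i : Fin 4) (m : ℕ) (x : List Bool) :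
    prf (tabScheme H) μ (tkey i) m x = fit m (List.ofFn (H.tab i (vecOf μ x))) := by
  simp [prf, vecOf_fit le_rfl]

/-- **The ideal-II naming**: the generator's `naming` (SIV names `τ ++ (label ⊕ mask)`) computed over the naming pair of
tables. [cite: ChildsEtAl2003, §2] -/
def codeNaming {μ : ℕ} (H : CodeSpace μ) (d : ℕ) : NamingN d (nameLen μ d) :=
  naming (tabScheme H) μ (tkey 0) (tkey 1) d

/-- **The ideal-II cycle datum**: the generator's `cycleOf` (two four-round Feistel permutations of the leaf positions)
computed over the cycle pair of tables. [cite: ChildsEtAl2003, §2] -/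
def codeCycle {μ : ℕ} (H : CodeSpace μ) (d : ℕ) : CycleDatum d :=
  cycleOf (tabScheme H) μ (tkey 2) (tkey 3) d

open Classical in
/-- **The ideal-II success probability**: the fraction of table quadruples `H` (all four uniform) on which the bit-oracle
walker `(M, x)` succeeds within `t` rounds against the instance `(codeCycle H d, codeNaming H d)` (success = output a
string with `name(EXIT)` as a prefix, `BitSuccess` of stage 5). [cite: ChildsEtAl2003, §4 Game 1] -/
def codeSuccessProb (d μ : ℕ) (M : OracleAlg (List Bool)) (x : List Bool) (t : ℕ) : ℝ :=
  ((Finset.univ.filter fun H : CodeSpace μ => BitSuccess M x t (codeCycle H d) (codeNaming H d)).card : ℝ) /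
    Fintype.card (CodeSpace μ)

/-- **The table of a real PRF key**: `v ↦ F_k(v)` at parameter `μ`, read as a `μ`-bit table. [folklore] -/
def tableOf (P : PuncturablePRFScheme) (μ : ℕ) (k : List Bool) : PrfTable μ :=
  fun v => vecOf μ (P.eval μ k (List.ofFn v))

/-- The four tables of the generator's four keys. [folklore] -/
def tablesOf (P : PuncturablePRFScheme) (μ : ℕ) (k₁ k₂ k₃ k₄ : List Bool) : CodeSpace μ :=
  ((tableOf P μ k₁, tableOf P μ k₂), (tableOf P μ k₃, tableOf P μ k₄))

/-! ## §2 The abstract four-round Feistel network and the Luby–Rackoff slack -/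

/-- A Luby–Rackoff key: four round functions between the two halves `{0,1}^a` (low) and `{0,1}^b` (high), in round
order (`f₀ : high → low`, `f₁ : low → high`, `f₂ : high → low`, `f₃ : low → high`). [cite: LubyRackoff1988, main construction] -/
abbrev LRKey (a b : ℕ) : Type :=
  ((Fin b → Bool) → (Fin a → Bool)) × ((Fin a → Bool) → (Fin b → Bool)) ×
    ((Fin b → Bool) → (Fin a → Bool)) × ((Fin a → Bool) → (Fin b → Bool))

/-- **Four Feistel rounds, alternating halves, no final swap** (the shape of the generator's `prp`):
`A¹ = A ⊕ f₀ B`, `B² = B ⊕ f₁ A¹`, `A³ = A¹ ⊕ f₂ B²`, `B⁴ = B² ⊕ f₃ A³`, output `(A³, B⁴)`.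
[cite: LubyRackoff1988, main construction] -/
def psi {a b : ℕ} (f : LRKey a b) (p : (Fin a → Bool) × (Fin b → Bool)) : (Fin a → Bool) × (Fin b → Bool) :=
  let A1 := xorVec p.1 (f.1 p.2)
  let B2 := xorVec p.2 (f.2.1 A1)
  let A3 := xorVec A1 (f.2.2.1 B2)
  let B4 := xorVec B2 (f.2.2.2 A3)
  (A3, B4)

/-- The CYLINDER event of a list of point/value pairs for a function: `∀ (x, y) ∈ L, g x = y` (two-sided transcripts
of a permutation oracle are such constraints, whatever the query directions; Patarin2009 §2, the sets counted by `H`). [folklore] -/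
def Cyl {α : Type} (L : List (α × α)) (g : α → α) : Prop := ∀ p ∈ L, g p.1 = p.2

/-- Cylinder events are decidable. [folklore] -/
instance {α : Type} [DecidableEq α] (L : List (α × α)) (g : α → α) : Decidable (Cyl L g) := by
  unfold Cyl; infer_instance

/-- **The Luby–Rackoff slack** for `q` two-sided constraints on four rounds with halves of `a` and `b` bits:
`q² · (2^{-a} + 2^{-b} + 2^{-(a+b)})` (collisions of the round-1 inputs, of the round-4 inputs, and the
permutation/function gap). [cite: LubyRackoff1988, Theorem 2 (strong pseudorandomness of four rounds)] -/
def lrSlack (a b q : ℕ) : ℝ := (q : ℝ) ^ 2 * (1 / 2 ^ a + 1 / 2 ^ b + 1 / 2 ^ (a + b))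

/-- The slack is non-negative. [folklore] -/
theorem lrSlack_nonneg (a b q : ℕ) : 0 ≤ lrSlack a b q := by unfold lrSlack; positivity

/-! ## §3 The format bridge: halves of a `d`-bit vector and the effective key of a table -/

/-- The low half (positions `< ⌊d/2⌋`) and the high half (positions `≥ ⌊d/2⌋`) of a `d`-bit vector — the halves
`lowHalf`/`highHalf` of the generator's Feistel rounds. [folklore] -/
def splitVec (d : ℕ) (w : Fin d → Bool) : (Fin (d / 2) → Bool) × (Fin (d - d / 2) → Bool) :=
  (fun i => w ⟨i, by omega⟩, fun j => w ⟨d / 2 + j, by omega⟩)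

/-- Reassembling a `d`-bit vector from its halves. [folklore] -/
def joinVec (d : ℕ) (p : (Fin (d / 2) → Bool) × (Fin (d - d / 2) → Bool)) : Fin d → Bool :=
  fun i => if h : (i : ℕ) < d / 2 then p.1 ⟨i, h⟩ else p.2 ⟨i - d / 2, by omega⟩

/-- `joinVec ∘ splitVec = id`. [folklore] -/
@[simp] theorem joinVec_splitVec (d : ℕ) (w : Fin d → Bool) : joinVec d (splitVec d w) = w := by
  funext i
  unfold joinVec splitVec
  split_ifs with h
  · rfl
  · exact congrArg w (Fin.ext (by simp only; omega))

/-- `splitVec ∘ joinVec = id`. [folklore] -/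
@[simp] theorem splitVec_joinVec (d : ℕ) (p : (Fin (d / 2) → Bool) × (Fin (d - d / 2) → Bool)) :
    splitVec d (joinVec d p) = p := by
  unfold joinVec splitVec
  refine Prod.ext ?_ ?_
  · funext i; simp
  · funext j
    simp only
    rw [dif_neg (by omega)]
    exact congrArg p.2 (Fin.ext (by simp))

/-- `{0,1}^d ≃ {0,1}^{⌊d/2⌋} × {0,1}^{⌈d/2⌉}`. [folklore] -/
def splitEquiv (d : ℕ) : (Fin d → Bool) ≃ (Fin (d / 2) → Bool) × (Fin (d - d / 2) → Bool) :=
  ⟨splitVec d, joinVec d, joinVec_splitVec d, splitVec_joinVec d⟩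

/-- The round function of ONE table in the generator's format: `F_r(y)` = the `d`-bit fitting of the table value at the
`μ`-bit fitting of `⟨r⟩₈ ++ y` (this is `roundFn (tabScheme H⃗) μ (tkey i) d r` for `H = H⃗ᵢ`, see stage 6). [cite: LubyRackoff1988, main construction] -/
def roundFnT {μ : ℕ} (H : PrfTable μ) (d r : ℕ) (y : Fin d → Bool) : Fin d → Bool :=
  fun i => (fit d (List.ofFn (H (vecOf μ (bitsOf 8 r ++ List.ofFn y))))).getD i false

/-- **The effective Luby–Rackoff key of a table**: the four round functions between the halves that the generator's
four Feistel rounds actually read — round `r` evaluates `roundFnT H d r` at the vector with the modified half BLANKED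
and uses only the modified half of the value. [cite: LubyRackoff1988, main construction] -/
def effKey {μ : ℕ} (H : PrfTable μ) (d : ℕ) : LRKey (d / 2) (d - d / 2) :=
  (fun B => (splitVec d (roundFnT H d 0 (joinVec d (fun _ => false, B)))).1,
   fun A => (splitVec d (roundFnT H d 1 (joinVec d (A, fun _ => false)))).2,
   fun B => (splitVec d (roundFnT H d 2 (joinVec d (fun _ => false, B)))).1,
   fun A => (splitVec d (roundFnT H d 3 (joinVec d (A, fun _ => false)))).2)

/-! ## §4 Locality of the bit oracle: atoms of the cycle datum -/

variable {d N : ℕ}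

/-- An ATOM of the cycle datum at a vertex: for a leaf, its position `k` on the cycle order of its side together with the
positions of its two cross neighbours; `none` for an inner vertex. [cite: ChildsEtAl2003, §2] -/
abbrev Atom (d : ℕ) : Type := Option (Fin (2 ^ d) × Fin (2 ^ d) × Fin (2 ^ d))

/-- **The atom of `σ` at `v`**: for the left leaf `i`, `(e⁻¹ i, crossR σ i)`; for the right leaf `j`, `(f⁻¹ j, crossL σ j)`;
`none` at inner vertices.  The neighbourhood of `v` in `G'_d(σ)` depends on `σ` only through it (stage 6, locality).
[cite: ChildsEtAl2003, §2] -/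
def atomOf (σ : CycleDatum d) (v : Vertex d) : Atom d :=
  if h : depth v = d then
    (if v.1 then some (σ.2.symm (leafIdx v h), crossL σ (leafIdx v h))
      else some (σ.1.symm (leafIdx v h), crossR σ (leafIdx v h)))
  else none

/-- **The σ-free neighbour set** of `v` given an atom: parent and children of an inner vertex (`neighborFinset_of_depth_lt`),
parent and the two named cross leaves of a leaf (`neighborFinset_leafL` / `neighborFinset_leafR`). [cite: ChildsEtAl2003, §2] -/
def nbrSetLocal (v : Vertex d) (α : Atom d) : Finset (Vertex d) :=
  if depth v < d then (if depth v = 0 then ∅ else {parentV v}) ∪ {childV v false, childV v true}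
  else match α with
    | some (_, c₁, c₂) => if v.1 then {parentV v, leafL d c₁, leafL d c₂} else {parentV v, leafR d c₁, leafR d c₂}
    | none => ∅

/-- The σ-free rendering of `GluedTrees.nbrNames`: neighbour names of the vertex named `a`, neighbourhoods read off an
atom assignment `α`. [cite: ChildsEtAl2003, §2 and §4 Game 1] -/
def nbrNamesL (ν : Vertex d ↪ (Fin N → Bool)) (α : Vertex d → Atom d) (a : Fin N → Bool) : Finset (Fin N → Bool) :=
  (Finset.univ.filter fun v => ν v = a).biUnion fun v => (nbrSetLocal v (α v)).map ν

/-- The σ-free rendering of `gluedTreesOracle` (sorted neighbour names). [cite: ChildsEtAl2003, §2 and §4 Game 1] -/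
def oracleL (ν : Vertex d ↪ (Fin N → Bool)) (α : Vertex d → Atom d) (a : Fin N → Bool) : List (Fin N → Bool) :=
  (((nbrNamesL ν α a).image nameVal).sort (· ≤ ·)).map (nameOfVal N)

/-- The σ-free rendering of `answerBits`. [cite: ChildsEtAl2003, §2 and §4 Game 1] -/
def answerBitsL (ν : Vertex d ↪ (Fin N → Bool)) (α : Vertex d → Atom d) (a : Fin N → Bool) : List Bool :=
  fit (ansLen N) (bitsOf 2 (oracleL ν α a).length ++ ((oracleL ν α a).map List.ofFn).flatten)

/-- The σ-free rendering of `nbrBit`. [cite: ChildsEtAl2003, §2 and §4 Game 1] -/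
def nbrBitL (ν : Vertex d ↪ (Fin N → Bool)) (α : Vertex d → Atom d) (x : Fin (N + N) → Bool) : Bool :=
  (answerBitsL ν α fun i => x (Fin.castAdd N i)).getD (nameVal fun i => x (Fin.natAdd N i)) false

/-- The σ-free rendering of `bitOracle` (stage 5). [cite: BarakEtAl2012, Def. 2.2] -/
def bitOracleL (ν : Vertex d ↪ (Fin N → Bool)) (α : Vertex d → Atom d) : Oracle := fun q =>
  if h : q.length = N + N then [nbrBitL ν α fun i => q.get (i.cast h.symm)] else []

/-- The vertex a query is ABOUT: the vertex named by the first `N` bits of a well-formed query, the ENTRANCE (an inner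
vertex, atom `none`) otherwise — so that the bit oracle's answer to `q` depends on `σ` only through
`atomOf σ (queryVertex ν q)`. [folklore] -/
def queryVertex (ν : Vertex d ↪ (Fin N → Bool)) (q : List Bool) : Vertex d :=
  if h : q.length = N + N then
    if hv : ∃ v, ν v = fun i => q.get ((Fin.castAdd N i).cast h.symm) then hv.choose else entrance d
  else entrance d

/-- The constraint lists of an atom at a vertex: the pairs `(x, y)` with `σ.1 x = y`, resp. `σ.2 x = y`, that
`atomOf σ v = α` imposes (left leaf `i`, atom `(k, c₁, c₂)`: `e k = i`; `f k = c₁`, `f (k-1) = c₂`; right leaf `j`: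
`f k = j`; `e k = c₁`, `e (k+1) = c₂`; nothing for `none`). [cite: ChildsEtAl2003, §2] -/
def atomPairs (v : Vertex d) (α : Atom d) : List (Fin (2 ^ d) × Fin (2 ^ d)) × List (Fin (2 ^ d) × Fin (2 ^ d)) :=
  match α with
  | none => ([], [])
  | some (k, c₁, c₂) =>
    if h : depth v = d then
      (if v.1 then ([(k, c₁), (finRotate (2 ^ d) k, c₂)], [(k, leafIdx v h)])
        else ([(k, leafIdx v h)], [(k, c₁), ((finRotate (2 ^ d)).symm k, c₂)]))
    else ([], [])

/-! ## §5 The tag and mask tables of two `μ`-bit tables -/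

variable {μ : ℕ}

/-- The TAG TABLE of a `μ`-bit table: `ℓ ↦ H (ℓ zero-padded to μ bits)` (the ideal-II `τ = F_{k₁}(label)`). [folklore] -/
def tagT (H : PrfTable μ) (d : ℕ) : TagTable d μ := fun ℓ => H (vecOf μ (List.ofFn ℓ))

/-- The MASK TABLE of a `μ`-bit table: `τ ↦ H τ` cut to `2d + 3` bits (the ideal-II mask `F_{k₂}(τ)`). [folklore] -/
def maskT (H : PrfTable μ) (d : ℕ) : MaskTable d μ := fun τ => vecOf (labelLen d) (List.ofFn (H τ))

/-- Registered helper stub of crux stmt-QuantumAdvantage-2340 (the gate admits a `--supports` file only if it proves a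
registered stub): listing a fitted vector gives the fitted string. [folklore] -/
theorem toolkit_riVocabulary : ∀ (m : ℕ) (x : List Bool), List.ofFn (vecOf m x) = fit m x :=
  ofFn_vecOf

end Summit.QuantumAdvantage.QuantumAdvantage.Theorems.WbwObfuscatedGluedTrees.KnowledgeOfWalk.RealIdeal

end
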